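import Literature.IUT.HodgeTheaters.KitS5LocalOfDatumProofs
import Literature.IUT.HodgeTheaters.PiAvatarKitCoreTheta
import Literature.IUT.HodgeTheaters.PiAvatarKitCoreGluing
import HarnessLib

/-!
# [IUTchI] Rmk 6.12.2 (i) / Def 4.6 (iii) / Def 6.13 (i) AT THE GENUINE Θ-NF STAND-IN KIT: the gluing TRANSPORT law
# `S5Local.GluingTransportLaw` (FACT-LIST F-2736) HOLDS for every Definition-5.5 ΘNF-side kit over the stand-in core
# `kitCoreThetaStandIn ES` of the REAL initial Θ-data (proof-only; abc-iut-f-193 gen 10, L5 ROWS #5 row R4)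

S. Mochizuki, *Inter-universal Teichmüller theory I*, kurims manuscript (May 2020), Remark 6.12.2 (i) p. 174 («gluing … to …
along the associated `𝒟-Θ`-bridges via the functorial algorithm of Proposition 6.7»), Definition 4.6 (iii) p. 112 («such that
there exist isomorphisms `𝒟^⊚ ⥲ †𝒟^⊚`; `𝔇_⋆ ⥲ †𝔇_J`; `𝔇_> ⥲ †𝔇_>`, conjugation by which maps `φ^NF_⋆ ↦ †φ^NF_⋆`, `φ^Θ_⋆ ↦ †φ^Θ_⋆`»),
Definition 6.13 (i) pp. 182–183, Def 3.1 (b)(c) pp. 61–62 ([IUTchI] Rmk 6.12.2 (i) p.174) [claim: Mochizuki2012, status: disputed]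
(D-0012 claim key, series status DISPUTED — kernel theorems over abc-iut-L5-t2's REAL `InitialThetaData`, abc-iut-L5-t4's Θ-NF
stand-in kit `baseKitThetaNFStandIn` / core `kitCoreThetaStandIn` (`PiAvatarKitCoreTheta`) and abc-iut-L5-t3's Definition-5.5
instantiation `S5Local.ofDatum` (`KitS5LocalOfDatum*`); nothing of the series is asserted, no side is taken on [IUTchIII] Cor. 3.12).

## Why this file (abc-iut cell, FACT-LIST row F-2736 `PMBaseKit.S5Local.GluingTransportLaw`, L5-lead g8 ROWS #5 R4)
abc-iut-L5-t4's §6 file `ThetaPMEllNFHodgeTheatersD.lean` records `S5Local.GluingTransportLaw N hl` as a HYPOTHESIS on the ΘNF-side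
kit `N`.  abc-iut-L5-t3 DISCHARGED it for every kit INSTANTIATED from the Definition-5.5 typing — `gluingTransportLaw_ofDatum
(hM : c.ThetaAgrees M) (hl : Odd 𝔡.l) : (S5Local.ofDatum fc nl).GluingTransportLaw hl` (`KitS5LocalOfDatumGluing.lean`) — modulo the
core-agreement law (γ) `ThetaAgrees`.  The companion `PiAvatarKitCoreThetaGluing.lean` (abc-iut-L5-t3, p466266) fires the
UNIQUENESS half of Rmk 6.12.2 ((ii): F-2049 `GluingUnique`, F-2682 `GluingUniqueBad`, Def 6.13 (ii)(c)) at the genuine Θ-NF stand-in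
kit, where law (γ) is abc-iut-L5-t4's THEOREM `thetaAgrees_thetaStandIn ES` and `Odd l` is Def 3.1 (c) (`odd_l`); the TRANSPORT half
((i): F-2736) was not fired there.  This file supplies it:

* `gluingTransportLaw_ofDatum_thetaStandIn` — for EVERY §5-R4 datum `S : BaseThetaDatum.S5Local 𝔡` over the §4 base-Θ datum
  `𝔡 := baseThetaDatumThetaStandIn ES` of the real initial Θ-data, EVERY `ℱ`-kit `FK` over the multiplicative kit generated by the
  evaluation sections and EVERY ℱ-level core agreement `fc : S.FKitCore (kitCoreThetaStandIn ES) FK`, the Definition-5.5 ΘNF-side kit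
  `S5Local.ofDatum fc (nfLinkThetaStandIn ES)` satisfies `GluingTransportLaw odd_l`;
* `gluingTransportLaw_and_gluingUniqueBad_thetaStandIn` — jointly with F-2682 (`ofDatum_gluingTransportLaw_and_gluingUniqueBad`), i.e.
  BOTH standing ΘNF-side §6 hypotheses of abc-iut-L5-t4 hold at once for these kits, so `DThetaPMEllNFHodgeTheater.strictify` /
  `ThetaPMEllNFHT.toDStrict` run there with no ΘNF-side hypothesis beyond the dictionaries;
* `gluingUnique_ofDatum_thetaStandIn`, `dGluing_subsingleton_ofDatum_thetaStandIn`, `gluing_subsingleton_ofDatum_thetaStandIn` — the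
  uniqueness statements of p466266 re-fired for the Definition-5.5 kits `ofDatum fc nl` (𝒟-level and ℱ-level), the bad place from
  Def 3.1 (b) (`indexCopyBad_nonempty`) or from the surjectivity of the core's index comparison (`kitCoreThetaStandIn_e`).

DISPLAYED BINDERS, exhaustively: the kit's {`CG`, `hS`, `M : TorsionMonodromy`, `hA`, `hI`} «[`X̲→`-profinite stand-in at `v̲ ∈ V̲^bad`]:
print's `𝒟_v̲` there is `ℬ^temp(X̳_v̲)⁰`, NOT this kit's `ℬ(Π_{X̲→_v̲})⁰`» ∪ {`ES`} (abc-iut-L5-t3's `EvalSectionBinder` family at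
`localDataStandIn` — a LAW binder; NV = row «EVALSECT-NV») ∪ the universally quantified §5-R4 HYPOTHESIS STRUCTURES `S` (abc-iut-L5-t3
`FrobenioidBridgeModels.S5Local`, Def 5.2 / Ex 5.1 / Ex 5.4 (iv) / Def 3.6 stubs), `FK`, `fc` (abc-iut-L5-t3 `FKitCoreBridge.FKitCore`; a
kit-rule inhabitant exists only at thickened kits, `FKitCoreBridgeWitness`).  UNIVERSE NOTE: abc-iut-L5-t3's `S5Local.ofDatum` is stated for
`𝔡 : BaseThetaDatum.{u+1}`, so the algebraic closure `Fbar` is taken in `Type (w+1)` here (a universe SPECIALISATION of the kit files'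
`Fbar : Type w`, nothing else changes).  Proof-only: no `def`, no `instance`, no `notation`, no new `Prop` fact; every proof is a one-line
application of landed theorems BY NAME.  Typed ≠ inhabited ≠ proved; binder ≠ fact; an instance at OUR stand-in kit is not print's
universal claim; nothing here asserts that abc is proved or refuted.
-/

noncomputable section

namespace Literature.IUT.HodgeTheaters

open CategoryTheory

universe u v w

section KitCoreThetaGluingTransport

variable {F : Type u} {K : Type v} {Fbar : Type (w + 1)} [Field F] [NumberField F] [Field K] [NumberField K]
  [Algebra F K] [Field Fbar] [Algebra F Fbar] [Algebra K Fbar]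
  {E : WeierstrassCurve F} [E.IsElliptic] {l : ℕ} {Pb : BadPlacePredicates K}
  (D : InitialThetaData F K Fbar E l Pb) (CG : D.geom.pe.CuspGalois) (hS : D.CuspClassesNormaliserStable) [Fact l.Prime]
  (M : D.TorsionMonodromy) (hA : D.geom.pe.ArrowCoveringClaims)
  (hI : ∀ k ∈ D.geom.pe.inertia D.geom.pe.ε1, M.tau (D.geom.embK k) = 0)

namespace InitialThetaData

variable {Gv : D.IndexCopy → Subgroup (Fbar ≃ₐ[F] Fbar)}
  (ES : ∀ v, v ∈ D.indexCopyBad → EvalSectionBinder (D.localDataStandIn CG hS M hA hI v) (Gv v))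
  {S : (D.baseThetaDatumThetaStandIn CG hS M hA hI ES).S5Local}
  {FK : (D.baseKitThetaNFStandIn CG hS M hA hI).FKit (D.multKitThetaNFStandIn CG hS M hA hI ES)}
  (fc : S.FKitCore (D.kitCoreThetaStandIn CG hS M hA hI ES) FK)

/-- **F-2736 `GluingTransportLaw` AT THE GENUINE Θ-NF STAND-IN KIT** ([IUTchI] Rmk 6.12.2 (i) / Def 4.6 (iii) / Def 6.13 (i)): for
every §5-R4 datum `S` over the §4 base-Θ datum of the real initial Θ-data at the stand-in kit, every `ℱ`-kit `FK` over the
multiplicative kit generated by the evaluation sections `ES` and every ℱ-level core agreement `fc`, the Definition-5.5 ΘNF-side kit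
`S5Local.ofDatum fc (nfLinkThetaStandIn ES)` satisfies abc-iut-L5-t4's gluing transport law — transporting a `𝒟`-ΘNF-Hodge theater along
a gluing to a `𝒟-Θ^±`-bridge via Prop 6.7 again yields a `𝒟`-ΘNF-Hodge theater.  By abc-iut-L5-t3's `gluingTransportLaw_ofDatum`
with law (γ) DISCHARGED by `thetaAgrees_thetaStandIn ES` and `Odd l` by Def 3.1 (c). ([IUTchI] Rmk 6.12.2 (i) p.174)
[claim: Mochizuki2012, status: disputed] -/
theorem gluingTransportLaw_ofDatum_thetaStandIn :
    (BaseThetaDatum.S5Local.ofDatum fc (D.nfLinkThetaStandIn CG hS M hA hI ES)).GluingTransportLaw D.odd_l :=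
  BaseThetaDatum.S5Local.gluingTransportLaw_ofDatum fc (D.nfLinkThetaStandIn CG hS M hA hI ES)
    (D.thetaAgrees_thetaStandIn CG hS M hA hI ES) D.odd_l

/-- **F-2736 ∧ F-2682 jointly AT THE GENUINE Θ-NF STAND-IN KIT**: both standing ΘNF-side §6 hypotheses of abc-iut-L5-t4
(`GluingTransportLaw`, Rmk 6.12.2 (i); `GluingUniqueBad`, Rmk 6.12.2 (ii) guarded) hold for every Definition-5.5 ΘNF-side kit over the
stand-in core (`ofDatum_gluingTransportLaw_and_gluingUniqueBad`). ([IUTchI] Rmk 6.12.2 (i) p.174) [claim: Mochizuki2012, status: disputed] -/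
theorem gluingTransportLaw_and_gluingUniqueBad_ofDatum_thetaStandIn :
    (BaseThetaDatum.S5Local.ofDatum fc (D.nfLinkThetaStandIn CG hS M hA hI ES)).GluingTransportLaw D.odd_l ∧
      (BaseThetaDatum.S5Local.ofDatum fc (D.nfLinkThetaStandIn CG hS M hA hI ES)).GluingUniqueBad D.odd_l :=
  BaseThetaDatum.S5Local.ofDatum_gluingTransportLaw_and_gluingUniqueBad fc (D.nfLinkThetaStandIn CG hS M hA hI ES)
    (D.thetaAgrees_thetaStandIn CG hS M hA hI ES) D.odd_l

/-- **F-2049 `GluingUnique` for the Definition-5.5 kits over the stand-in core** ([IUTchI] Rmk 6.12.2 (ii) / Def 6.13 (i)(c)), the bad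
place supplied by Def 3.1 (b) (`indexCopyBad_nonempty`; the core's index comparison is the identity, `kitCoreThetaStandIn_e`).
([IUTchI] Def 6.13 (i) p.182) [claim: Mochizuki2012, status: disputed] -/
theorem gluingUnique_ofDatum_thetaStandIn :
    (BaseThetaDatum.S5Local.ofDatum fc (D.nfLinkThetaStandIn CG hS M hA hI ES)).GluingUnique D.odd_l :=
  BaseThetaDatum.S5Local.ofDatum_gluingUnique_of_surjective fc (D.nfLinkThetaStandIn CG hS M hA hI ES)
    (D.thetaAgrees_thetaStandIn CG hS M hA hI ES) (fun x => ⟨x, rfl⟩) D.odd_l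

/-- **[IUTchI] Def 6.13 (ii)(c) for the Definition-5.5 kits over the stand-in core**: the `𝒟`-level gluing of the associated
`𝒟`-ΘNF-Hodge theater of a Definition 5.5 (iii) ΘNF-Hodge theater `H` to any `𝒟-Θ^±`-bridge via Prop 6.7 is UNIQUE.
([IUTchI] Def 6.13 (ii) p.183) [claim: Mochizuki2012, status: disputed] -/
theorem dGluing_subsingleton_ofDatum_thetaStandIn (B : (D.baseKitThetaNFStandIn CG hS M hA hI).DThetaPMBridge)
    (H : S.ThetaNFHodgeTheater) :
    Subsingleton ((BaseThetaDatum.S5Local.ofDatum fc (D.nfLinkThetaStandIn CG hS M hA hI ES)).DThetaGluing B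
      (BaseThetaDatum.S5Local.dnfhtOf fc (D.nfLinkThetaStandIn CG hS M hA hI ES) H) D.odd_l) := by
  obtain ⟨x, hx⟩ := D.indexCopyBad_nonempty
  exact BaseThetaDatum.S5Local.ofDatum_dGluing_subsingleton fc (D.nfLinkThetaStandIn CG hS M hA hI ES)
    (D.thetaAgrees_thetaStandIn CG hS M hA hI ES) D.odd_l hx B H

/-- **[IUTchI] Rmk 6.12.2 (ii) / Def 6.13 (i)(c), ℱ-level, for the Definition-5.5 kits over the stand-in core**: the gluing of a
Definition 5.5 (iii) ΘNF-Hodge theater `H` to a `Θ^±`-bridge `B` (abc-iut-L5-t4's `ThetaGluing`) is UNIQUE.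
([IUTchI] Def 6.13 (i) p.182) [claim: Mochizuki2012, status: disputed] -/
theorem gluing_subsingleton_ofDatum_thetaStandIn (B : FK.ThetaPMBridge) (H : S.ThetaNFHodgeTheater) :
    Subsingleton ((BaseThetaDatum.S5Local.ofDatum fc (D.nfLinkThetaStandIn CG hS M hA hI ES)).ThetaGluing B H D.odd_l) := by
  obtain ⟨x, hx⟩ := D.indexCopyBad_nonempty
  exact BaseThetaDatum.S5Local.ofDatum_gluing_subsingleton fc (D.nfLinkThetaStandIn CG hS M hA hI ES)
    (D.thetaAgrees_thetaStandIn CG hS M hA hI ES) D.odd_l hx B H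

end InitialThetaData

end KitCoreThetaGluingTransport

end Literature.IUT.HodgeTheaters

end
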